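import Summits.BirchSwinnertonDyer.BirchSwinnertonDyer.Theorems.EisensteinPrimesAcTwistDeformationSurAtVbarOfDatum
import HarnessLib

/-!
# Route `EisensteinPrimes` (rung K5), crux 2 `GoodLatticeBDPValue`, line `halves` v20.1 (a012386a…): the SUR_θ
# conjuncts of `stub_indexInputs` from its OWN antecedents `hSsub` / `hSquot` (`∀ D : DatumDualData … ↑Sf,
# Module.Finite ∧ IsTorsion ∧ μ = 0`) — one literal application each (helper for stmt-BirchSwinnertonDyer-19032)

Cell `bsd-eis` (home `run/shared/lean/pub/bsd-eis/`), seat `bsd-line-x1-p1-w3` gen 3. The REGISTERED skeleton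
halves v20.1 (`Cruxes/GoodLatticeBDPValue/Lines/halves.lean`, sha256 a012386a…, l.248–345) gives
`stub_indexInputs` the antecedents the seat asked for (HOME/STATUS.md 2026-08-28 ≈16:25Z): the nine published
facts and, for the characters, `∀ D : DatumDualData κ γ (charModule ∅ θsub) (bdpData …) ↑Sf, Module.Finite ∧
IsTorsion ∧ μ = 0` (l.271–276; likewise `θquot`). The seat's `char_forall_fin_…_of_datum` (p649420) takes ONE
datum with `Module.Finite ∧ IsTorsion`; THIS FILE is the two-line wrapper choosing the datum
(`KellerYin2024.nonempty_unrDualData_char`), so that in the stub's proof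
`hsur₁ := char_forall_fin_exists_unramifiedOutside_resOfLe_conjH1_pow_eq_of_forall_datum h263 h41 h42 h5A h32 W hp
hK hH hvι hv̄ hne κ hκ γ hpair Sf hSf θsub (Or.inl rfl) hSsub c hc hcd` and `hsur₃ := … θquot (Or.inr rfl) hSquot
c hc hcd` (with `τ := (γ ^ ·)` and `(c, hc, hcd)` from w5's `IndexInputsReps.exists_pow_generates_decomp_of_isImaginaryQuadratic`
/ `reps_package_of_pow_generates`), while `hsur₂ := curve_forall_fin_exists_unramifiedOutside_resOfLe_conjH1_pow_eq …
hSsub hSquot c hc hcd` (p647873) or `…_of_xAc … hfgS htorS c hc hcd` (p649420).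

Theorems only; conditional only through the by-name published facts and the stub's own antecedent; no
definition, no named fact, no `sorry`. HONEST FRAMING: closes nothing by itself (`--supports`); no summit
statement / BSD / IMC2 / KY Thm. 1.4.1 (iii) is proved by this file; 0 stubs / cells / labels move.
References: [Greenberg2016Selmer] Prop. 2.6.3; [Greenberg2006] Props. 3.2, 4.1, 4.2, §5 A; [KellerYin2024]
Thm. 1.2.2, Rem. 1.4.2 (arXiv:2402.12781v2).
-/

set_option autoImplicit false
set_option linter.dupNamespace false

noncomputable section

open scoped Classical
open NumberField IsDedekindDomain Field Multiplicative PowerSeries WeierstrassCurve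
open Literature.NumberTheory.EllipticCurves Literature.NumberTheory.EllipticCurves.GreenbergSelmer
  Literature.NumberTheory.EllipticCurves.GreenbergVatsal2000 Literature.NumberTheory.GaloisRepresentations
  Literature.NumberTheory.EllipticCurves.KellerYin2024 Literature.NumberTheory.EllipticCurves.IwasawaDual
  Literature.NumberTheory.EllipticCurves.Castella2018.AcSelmer
  Literature.NumberTheory.IwasawaTheory Literature.NumberTheory.IwasawaTheory.Greenberg2016
  Literature.NumberTheory.IwasawaTheory.Greenberg2006
  Summit.BirchSwinnertonDyer.BirchSwinnertonDyer.Theorems.GreenbergFullAtSelmer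
  Summit.BirchSwinnertonDyer.BirchSwinnertonDyer.Theorems.AcTwistDeformationResidualPair

namespace Summit.BirchSwinnertonDyer.BirchSwinnertonDyer.Theorems.AcTwistDeformation

section SurAtVbarOfForallDatum

variable {K : Type} [Field K] [NumberField K] {p : ℕ} [Fact p.Prime]

/-- **SUR_θ at `v̄` in the `hsur` currency, from v20.1's own antecedent `∀ D : DatumDualData … ↑Sf,
Module.Finite ∧ IsTorsion ∧ μ = 0`** (`hSsub` for `θ = θsub`, `hSquot` for `θ = θquot`): for any `c` with
`κ(D_v̄) = p^c ℤ_p` exactly, every `y : Fin (p^c) → H¹(ker κ ⊓ D_v̄, (F/𝒪)(θ))` is `(res_{ker κ ⊓ D_v̄}(conj_{γ^i} u))_i`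
for some `u ∈ unramifiedOutside κ.kerSubgroup (F/𝒪)(θ) p ↑Sf`. A datum exists
(`KellerYin2024.nonempty_unrDualData_char`); apply `char_forall_fin_…_of_datum` to it.
[cite: Greenberg2016Selmer, Prop. 2.6.3 (c), §4.3 pp. 20–21] [cite: KellerYin2024, Thm. 1.2.2 and Rem. 1.4.2 (arXiv:2402.12781v2 TeX L1130–1140)] -/
theorem char_forall_fin_exists_unramifiedOutside_resOfLe_conjH1_pow_eq_of_forall_datum
    (h263 : prop263_sur_of_crk)
    (h41 : prop41_globalEulerPoincareCorank) (h42 : prop42_localEulerPoincareCorank)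
    (h5A : sec5A_localH2_subsingleton_of_LOC1) (h32 : prop32_cohomology_isCofinitelyGenerated)
    (W : WeierstrassCurve ℚ) [W.IsElliptic] (hp : 2 < p) (hK : IsImaginaryQuadratic K)
    (hH : SatisfiesHeegnerHypothesis (W.conductorNorm ℤ) K)
    {ι : K →+* ℚ_[p]} {v vbar : HeightOneSpectrum (𝓞 K)}
    (hvι : ∀ x : 𝓞 K, x ∈ v.asIdeal ↔ ‖ι (x : K)‖ < 1)
    (hvbar : ((p : ℕ) : 𝓞 K) ∈ vbar.asIdeal) (hne : vbar ≠ v)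
    (κ : ZpExtension K p) (hκ : κ.IsAnticyclotomic) (γ : absoluteGaloisGroup K)
    [hγ : Fact (κ.IsTopGenerator γ)]
    {θsub θquot : FramedGaloisRep K (padicCoeffIntegers (∅ : Set (PadicAlgCl p))) 1}
    (hpair : IsResidualPairOver (W.baseChange K) p θsub θquot)
    (Sf : Finset (HeightOneSpectrum (𝓞 K)))
    (hSf : ∀ w : HeightOneSpectrum (𝓞 K), w ∈ Sf ↔ ((W.conductorNorm ℤ : ℤ) : 𝓞 K) ∈ w.asIdeal)
    (θ : FramedGaloisRep K (padicCoeffIntegers (∅ : Set (PadicAlgCl p))) 1) (hθ : θ = θsub ∨ θ = θquot)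
    (hSθ : ∀ D : DatumDualData κ γ (charModule (∅ : Set (PadicAlgCl p)) θ)
      (Castella2018.AcSelmer.bdpData (charModule (∅ : Set (PadicAlgCl p)) θ) p vbar)
      (↑Sf : Set (HeightOneSpectrum (𝓞 K))),
      Module.Finite (IwasawaAlgebra p) D.X ∧ Module.IsTorsion (IwasawaAlgebra p) D.X ∧ muInvariant p D.X = 0)
    (c : ℕ) (hc : ∃ δ ∈ decomp (K := K) vbar, (κ δ).toAdd = (p : ℤ_[p]) ^ c)
    (hcd : ∀ δ ∈ decomp (K := K) vbar, (p : ℤ_[p]) ^ c ∣ (κ δ).toAdd) :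
    ∀ y : Fin (p ^ c) →
        subgroupH1 (κ.kerSubgroup ⊓ decomp (K := K) vbar) (charModule (∅ : Set (PadicAlgCl p)) θ),
      ∃ u ∈ unramifiedOutside κ.kerSubgroup (charModule (∅ : Set (PadicAlgCl p)) θ) p
          (↑Sf : Set (HeightOneSpectrum (𝓞 K))),
        ∀ i : Fin (p ^ c),
          resOfLe (charModule (∅ : Set (PadicAlgCl p)) θ)
            (inf_le_left : κ.kerSubgroup ⊓ decomp (K := K) vbar ≤ κ.kerSubgroup)
            (conjH1 κ.kerSubgroup (charModule (∅ : Set (PadicAlgCl p)) θ) (γ ^ (i : ℕ)) u) = y i := by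
  obtain ⟨D⟩ := nonempty_unrDualData_char (∅ : Set (PadicAlgCl p)) θ κ vbar
    (↑Sf : Set (HeightOneSpectrum (𝓞 K))) hγ.out
  obtain ⟨hDfin, hDtor, -⟩ := hSθ D
  exact char_forall_fin_exists_unramifiedOutside_resOfLe_conjH1_pow_eq_of_datum h263 h41 h42 h5A h32 W hp hK hH
    hvι hvbar hne κ hκ γ hpair Sf hSf θ hθ D hDfin hDtor c hc hcd

end SurAtVbarOfForallDatum

end Summit.BirchSwinnertonDyer.BirchSwinnertonDyer.Theorems.AcTwistDeformation

end
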